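import Literature.NumberTheory.PAdicHodge.DualExpEllipticTower
import Literature.NumberTheory.EllipticCurves.Kato2004.EulerSystemValues
import Literature.NumberTheory.EllipticCurves.BSDConductorProofs
import Literature.NumberTheory.AdelicBaseChange.PadicTensorCompletionGaloisProofs
import Literature.NumberTheory.GaloisRepresentations.LevelFieldLocalization
import Literature.NumberTheory.GaloisRepresentations.LocalGlobalCohomology
import Literature.NumberTheory.GaloisRepresentations.PadicAlgebraOfLocalField
import Literature.NumberTheory.GaloisRepresentations.PadicAlgebraDegreeOnePlace
import Literature.NumberTheory.PAdicHodge.FontaineThetaLocalField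
import HarnessLib

/-!
# Kato 2004 (Astérisque 295) with the dual exponential DEFINED: (8.1.3)/Ex. 13.3, Prop. 8.12, §9.4 + §11.3, Thm. 9.7,
# Thm. 6.6 (1) for the newform of an elliptic curve over `ℚ` — the value datum `Λ` IS the semi-local `exp*` of
# [BlochKato1990] §3 in the coordinate of a generator of `D⁰_dR` (the TODO(general form) of `EulerSystemValues`)

Typed by seat bsd-addord-w2-c2 (gen 9, 2026-08-27); consumer: the BSD cell's W2 deep family, whose one displayed
hypothesis hKatoExᵘ (`Summits/…/Theorems/KimAtThreeDeepLowerKatoPartsRescale.lean` l.81–163) it discharges. Same apparatus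
as `exists_eulerSystem_expStar_values` (this directory), whose `ZetaBody` (C1)–(C5) is used VERBATIM; the ONLY delta is
that the value datum `Λ` is no longer abstract: for SOME generator `d` of the `ℚ_v`-line `D⁰_dR(V_pW|_{Γ_{ℚ_v}})`
(`v = v_p`; `FilZeroLine` of `NeronDeRhamDatum.lean`) and, at every level `m = p^k·∏_{q∈r} ℓ_q`, for ONE place
`w₀ ∣ p` of `L = ℚ(ζ_m)` with a twist family `g : {w ∣ p} → Γ_ℚ`, `g̃_w • w = w₀`, and a generator `d_w₀` of `D⁰_dR`
of the TOWER representation at `L_{w₀}` which is RESTRICTION-COMPATIBLE with `d` ((RES): `exp*_{d_w₀}(η₀ ∘ res) =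
(ℚ_v → L_{w₀})(exp*_d η₀)` on cocycles), the `w`-component of `Λ_{k,r} y` under the semi-local isomorphism
`Ψ : ℚ_p ⊗ L ≃ ∏_{w∣p} L_w` ([CasselsFrohlichANT1967] II §10) is `(g̃_w⁻¹)_* exp*_{d_w₀}[ψT]` for the tower cocycle
`ψT` of any cocycle of `g_w · y` ((DEF)); here `exp*_{d_w₀}` is the tree's `PeriodRingData.dualExpCoord` for
`bdRPeriodRingData` at `L_{w₀}` and `log χ_cyclo`, on the rational Tate representation restricted along the COMPOSITE
`Γ_{L_{w₀}} → Γ_{ℚ_v} → Γ_ℚ` (= `expStarCoordTower` of `DualExpEllipticTower`, by the definitional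
`ContinuousRep.restrict_comp`).  PRINT: §9.4 p. 188 «we have the dual exponential map
`exp* : H¹(ℚ(ζ_m) ⊗ ℚ_p, V_{F_λ}(f)(i)) → S(f) ⊗_F F_λ ⊗ ℚ(ζ_m)`» (= the dual exponential of [BK90] §3 composed with
the comparison `D^i_dR(V_{F_λ}(f)) ≅ S(f) ⊗_F F_λ` of §11.3), Thm. 9.7 p. 189 «`exp*` sends `_{c,d}z_m^{(p)}(f,r,r′,ξ,S)`
to `_{c,d}z_m(f,r,r′,ξ,S) ∈ S(f) ⊗ ℚ(ζ_m)`» (RATIONAL values = `ZetaBody` (C4) for the generator `d` := the image of a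
`ℚ`-basis of the line `S(f)`, transported along `V_{ℚ_p}(f)(1) ≅ V_pW` — D1 (a) of `EulerSystemValues`; the tree's
`FilZeroLine.map` / `dualExpCoord_map` make the coordinate functional invariant under that transport).  READINGS (own
attribution, each ≤ 3 lines from print): the semi-local cohomology `H¹(ℚ(ζ_m) ⊗ ℚ_p, V) = ⊕_{w∣p} H¹(L_w, V)` and
`exp*` componentwise (§9.4); reading every component at ONE completion `L_{w₀}` through the Galois automorphism `g̃_w`
with `g̃_w • w = w₀` (transport of structure; the cell's kernel theorems `KimAtThreeFineKatoValueEquivariance` /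
(GAL_loc) show that `ZetaBody` (C3a) holds for such a `Λ`); the restriction-compatibility (RES) of the line data
(functoriality of `D_dR`/`exp*` in the field, Kato LNM 1553 II §1.2; the cell's kernel theorem
`KimAtThreeDeepLowerExpStarOmegaRes` produces such `d_w₀`).  NOT asserted: any duality / lattice / integrality statement
([BK90] Prop. 3.8 = the separate facts `DualExpElliptic(-Tower)`), any normalisation of `κ` or of `d` (scale-free: a
consumer holding a duality-normalised line rescales, `Summits/…/KimAtThreeDeepLowerKatoPartsRescale`), anything at the
archimedean place beyond (C5).  Hypotheses: `W[p]` irreducible, `f` the newform of `W`; none on the reduction at `p`.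
[cite: Kato2004Asterisque, (8.1.3) (p. 180), §8.2 (pp. 180–181), Lemma 8.5 (pp. 183–184), Prop. 8.12 (p. 186), §9.4 (p. 188), Thm. 9.7 (p. 189), §11.3, Thm. 6.6 (1) (p. 163), §13.1 (13.1.1), Ex. 13.3 (pp. 224–225)]
[cite: BlochKato1990, Def. 3.10 and §3 (the dual exponential map)] [cite: Kato1993LNM1553, Ch. II §1.2.4]
[cite: CasselsFrohlichANT1967, Ch. II §10 Theorem (10.2) and Ch. VII §1.1] [cite: Rubin2000, Def. 2.1.1 and Remark 2.1.4]
-/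

noncomputable section

open scoped BigOperators NumberField TensorProduct Pointwise
open Polynomial Field IsDedekindDomain NumberField CongruenceSubgroup ValuativeRel
open Literature.NumberTheory.GaloisRepresentations
open Literature.NumberTheory.GaloisRepresentations.PeriodRingData
open Literature.NumberTheory.GaloisRepresentations.IsNonarchimedeanLocalField
open Literature.NumberTheory.PAdicHodge
open Literature.NumberTheory.EllipticCurves Literature.NumberTheory.EllipticCurves.ModularForms
open Literature.NumberTheory.AdelicBaseChange Literature.NumberTheory.Automorphic

namespace Literature.NumberTheory.EllipticCurves.Kato2004

open EulerSystemValues Rat.HeightOneSpectrum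

/-! ## A private plumbing lemma (proved): the tower restriction lands in the level subgroup -/

set_option backward.isDefEq.respectTransparency false in
/-- **The tower restriction `Γ_{ℚ(ζ_m)_w} → Γ_{ℚ_v} → Γ_ℚ` lands in the level subgroup `cycSubgroup p k r`**
(`m = cycLevel p k r`; the completion contains the image of `ζ_m`, and `IsScalarTower ℚ ℚ_v ℚ(ζ_m)_w` holds because
ring maps out of `ℚ` are unique). [cite: Rubin2000, Ch. III §2.1] -/
private theorem absGaloisRestrictTower_completion_mem_cycSubgroup (p : ℕ) [Fact p.Prime] (k : ℕ)
    (r : Finset (HeightOneSpectrum (𝓞 ℚ)))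
    (w : ((Rat.HeightOneSpectrum.primesEquiv (R := 𝓞 ℚ)).symm ⟨p, Fact.out⟩).Extension
      (𝓞 (CyclotomicField (cycLevel p k r) ℚ)))
    (σ : absoluteGaloisGroup (w.1.adicCompletion (CyclotomicField (cycLevel p k r) ℚ))) :
    absGaloisRestrictTower ℚ (((Rat.HeightOneSpectrum.primesEquiv (R := 𝓞 ℚ)).symm ⟨p, Fact.out⟩).adicCompletion ℚ)
      (w.1.adicCompletion (CyclotomicField (cycLevel p k r) ℚ)) σ ∈ cycSubgroup p k r := by
  have hcomp : algebraMap ℚ (w.1.adicCompletion (CyclotomicField (cycLevel p k r) ℚ)) =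
      (algebraMap (((Rat.HeightOneSpectrum.primesEquiv (R := 𝓞 ℚ)).symm ⟨p, Fact.out⟩).adicCompletion ℚ)
        (w.1.adicCompletion (CyclotomicField (cycLevel p k r) ℚ))).comp
        (algebraMap ℚ (((Rat.HeightOneSpectrum.primesEquiv (R := 𝓞 ℚ)).symm ⟨p, Fact.out⟩).adicCompletion ℚ)) :=
    Subsingleton.elim _ _
  haveI hST : IsScalarTower ℚ (((Rat.HeightOneSpectrum.primesEquiv (R := 𝓞 ℚ)).symm ⟨p, Fact.out⟩).adicCompletion ℚ)
      (w.1.adicCompletion (CyclotomicField (cycLevel p k r) ℚ)) := IsScalarTower.of_algebraMap_eq' hcomp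
  have hζ := ((IsCyclotomicExtension.zeta_spec (cycLevel p k r) ℚ
      (CyclotomicField (cycLevel p k r) ℚ)).map_of_injective
    (algebraMap (CyclotomicField (cycLevel p k r) ℚ)
      (w.1.adicCompletion (CyclotomicField (cycLevel p k r) ℚ))).injective)
  change _ ∈ (cyclotomicLevelsRat p (∅ : Set (HeightOneSpectrum (𝓞 ℚ)))).level k r
  rw [cyclotomicLevelsRat_level]
  refine ⟨absGaloisRestrictTower_mem_rootsOfUnityFixer_of_dvd ℚ _ _ hζ (Dvd.intro _ rfl) σ, ?_⟩
  refine Subgroup.mem_iInf.2 fun q => Subgroup.mem_iInf.2 fun hq => ?_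
  exact absGaloisRestrictTower_mem_rootsOfUnityFixer_of_dvd ℚ _ _ hζ
    ((Finset.dvd_prod_of_mem _ hq).mul_left _) σ

/-! ## The named fact -/

section Fact

-- The tree's `ℚ`-algebra structure on `ℚ_v = Place.Completion (inr v)` (`NumberField.Place.instAlgebraCompletion`, this
-- library) gets top priority LOCALLY, so that class inference keeps choosing it — and not `DivisionRing.toRatAlgebra` —
-- once `CharZero ℚ_v` is in scope inside the statement (the two are equal, `Algebra ℚ _` being a subsingleton, but
-- only the former is definitionally the structure the BSD cell's `tateLocalRep` is built on).
attribute [local instance 100001] NumberField.Place.instAlgebraCompletion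


set_option backward.isDefEq.respectTransparency false in
/-- **Kato 2004 with `exp*` DEFINED** (see the module docstring; `ZetaBody` (C1)–(C5) of `EulerSystemValues` VERBATIM,
plus (RES)/(DEF) pinning `Λ` to the semi-local Bloch–Kato dual exponential in the coordinate of SOME generator `d` of
`D⁰_dR(V_pW|_{Γ_{ℚ_v}})`, read at one completion per level).  NOTE: the embedding family `ι` is EXISTENTIAL here
(the parent `exists_eulerSystem_expStar_values` quantifies `∀ ι` because its abstract `Λ` can be rotated level-wise; once
`Λ` is pinned to the defined `exp*`, only SOME `ι` is asserted — consumers must not expect `∀ ι`).  Named fact; nothing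
asserted; no `_holds` expected.
[cite: Kato2004Asterisque, (8.1.3) (p. 180), Prop. 8.12 (p. 186), §9.4 (p. 188), Thm. 9.7 (p. 189), §11.3, Thm. 6.6 (1) (p. 163), Ex. 13.3 (pp. 224–225)]
[cite: BlochKato1990, Def. 3.10 and §3] [cite: Kato1993LNM1553, Ch. II §1.2.4]
[cite: CasselsFrohlichANT1967, Ch. II §10 Theorem (10.2) and Ch. VII §1.1] -/
def exists_eulerSystem_definedExpStar_values : Prop :=
  ∀ (W : WeierstrassCurve ℚ) [W.IsElliptic] (p : ℕ) [Fact p.Prime]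
    [ContinuousSMul ℤ_[p] (W.tateModule p)] [Module.Free ℤ_[p] (W.tateModule p)]
    [Module.Finite ℤ_[p] (W.tateModule p)],
    W.HasIrreducibleModPGaloisRep p →
    ∀ {N : ℕ} [NeZero N] (f : CuspForm (Gamma0 N) 2), IsNewformOf W f →
        -- the restricted representations, named BEFORE the local-field structures of `ℚ_v` (their `ℚ`-algebra
        -- structure on `ℚ_v` is then `Place.instAlgebraCompletion`)
        letI ρT := restrictedTateRep W (NumberField.Place.Completion (Sum.inr ((Rat.HeightOneSpectrum.primesEquiv (R := 𝓞 ℚ)).symm ⟨p, Fact.out⟩) : NumberField.Place ℚ)) p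
        letI ρV := restrictedRationalTateRep W (NumberField.Place.Completion (Sum.inr ((Rat.HeightOneSpectrum.primesEquiv (R := 𝓞 ℚ)).symm ⟨p, Fact.out⟩) : NumberField.Place ℚ)) p
        letI : ValuativeRel (NumberField.Place.Completion (Sum.inr ((Rat.HeightOneSpectrum.primesEquiv (R := 𝓞 ℚ)).symm ⟨p, Fact.out⟩) : NumberField.Place ℚ)) :=
          inferInstanceAs (ValuativeRel (((Rat.HeightOneSpectrum.primesEquiv (R := 𝓞 ℚ)).symm ⟨p, Fact.out⟩).adicCompletion ℚ))
        letI : TopologicalSpace (NumberField.Place.Completion (Sum.inr ((Rat.HeightOneSpectrum.primesEquiv (R := 𝓞 ℚ)).symm ⟨p, Fact.out⟩) : NumberField.Place ℚ)) :=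
          inferInstanceAs (TopologicalSpace (((Rat.HeightOneSpectrum.primesEquiv (R := 𝓞 ℚ)).symm ⟨p, Fact.out⟩).adicCompletion ℚ))
        haveI : IsNonarchimedeanLocalField (NumberField.Place.Completion (Sum.inr ((Rat.HeightOneSpectrum.primesEquiv (R := 𝓞 ℚ)).symm ⟨p, Fact.out⟩) : NumberField.Place ℚ)) :=
          inferInstanceAs (IsNonarchimedeanLocalField (((Rat.HeightOneSpectrum.primesEquiv (R := 𝓞 ℚ)).symm ⟨p, Fact.out⟩).adicCompletion ℚ))
        haveI : CharZero (NumberField.Place.Completion (Sum.inr ((Rat.HeightOneSpectrum.primesEquiv (R := 𝓞 ℚ)).symm ⟨p, Fact.out⟩) : NumberField.Place ℚ)) := LocalField.charZero_adicCompletion ((Rat.HeightOneSpectrum.primesEquiv (R := 𝓞 ℚ)).symm ⟨p, Fact.out⟩)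
        letI : Algebra ℚ_[p] (NumberField.Place.Completion (Sum.inr ((Rat.HeightOneSpectrum.primesEquiv (R := 𝓞 ℚ)).symm ⟨p, Fact.out⟩) : NumberField.Place ℚ)) :=
          LocalField.adicCompletionPadicAlgebra ((Rat.HeightOneSpectrum.primesEquiv (R := 𝓞 ℚ)).symm ⟨p, Fact.out⟩) p ((natCast_mem_asIdeal_iff_eq_primesEquiv_symm _ (Fact.out : p.Prime)).mpr rfl)
        haveI : Fact (¬ IsUnit ((p : ℕ) : integerC (NumberField.Place.Completion (Sum.inr ((Rat.HeightOneSpectrum.primesEquiv (R := 𝓞 ℚ)).symm ⟨p, Fact.out⟩) : NumberField.Place ℚ)))) :=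
          ⟨not_isUnit_natCast_integerC (show valuation (NumberField.Place.Completion (Sum.inr ((Rat.HeightOneSpectrum.primesEquiv (R := 𝓞 ℚ)).symm ⟨p, Fact.out⟩) : NumberField.Place ℚ)) ((p : ℕ) : (NumberField.Place.Completion (Sum.inr ((Rat.HeightOneSpectrum.primesEquiv (R := 𝓞 ℚ)).symm ⟨p, Fact.out⟩) : NumberField.Place ℚ))) < 1 from LocalField.valuation_adicCompletion_natCast_lt_one ((Rat.HeightOneSpectrum.primesEquiv (R := 𝓞 ℚ)).symm ⟨p, Fact.out⟩) p ((natCast_mem_asIdeal_iff_eq_primesEquiv_symm _ (Fact.out : p.Prime)).mpr rfl))⟩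
        haveI := isAdicComplete_integerC_natCast (show valuation (NumberField.Place.Completion (Sum.inr ((Rat.HeightOneSpectrum.primesEquiv (R := 𝓞 ℚ)).symm ⟨p, Fact.out⟩) : NumberField.Place ℚ)) ((p : ℕ) : (NumberField.Place.Completion (Sum.inr ((Rat.HeightOneSpectrum.primesEquiv (R := 𝓞 ℚ)).symm ⟨p, Fact.out⟩) : NumberField.Place ℚ))) < 1 from LocalField.valuation_adicCompletion_natCast_lt_one ((Rat.HeightOneSpectrum.primesEquiv (R := 𝓞 ℚ)).symm ⟨p, Fact.out⟩) p ((natCast_mem_asIdeal_iff_eq_primesEquiv_symm _ (Fact.out : p.Prime)).mpr rfl))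
        ∃ (d : (bdRPeriodRingData (show valuation (NumberField.Place.Completion (Sum.inr ((Rat.HeightOneSpectrum.primesEquiv (R := 𝓞 ℚ)).symm ⟨p, Fact.out⟩) : NumberField.Place ℚ)) ((p : ℕ) : (NumberField.Place.Completion (Sum.inr ((Rat.HeightOneSpectrum.primesEquiv (R := 𝓞 ℚ)).symm ⟨p, Fact.out⟩) : NumberField.Place ℚ))) < 1 from LocalField.valuation_adicCompletion_natCast_lt_one ((Rat.HeightOneSpectrum.primesEquiv (R := 𝓞 ℚ)).symm ⟨p, Fact.out⟩) p ((natCast_mem_asIdeal_iff_eq_primesEquiv_symm _ (Fact.out : p.Prime)).mpr rfl))).FilZeroLine ρV),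
        ∃ (ι : (n : ℕ) → (CyclotomicField n ℚ →+* ℂ)) (κK : ℝ)
          (Λ : ∀ (k' : ℕ) (r : Finset (HeightOneSpectrum (𝓞 ℚ))),
            H1 (tateRep W p) (cycSubgroup p k' r) →ₗ[ℤ_[p]]
              ℚ_[p] ⊗[ℚ] CyclotomicField (cycLevel p k' r) ℚ),
          κK ≠ 0 ∧
          (∀ (k : ℕ) (r : Finset (HeightOneSpectrum (𝓞 ℚ)))
            (Ψ : ℚ_[p] ⊗[ℚ] CyclotomicField (cycLevel p k r) ℚ ≃ₐ[ℚ]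
              (Π w : ((Rat.HeightOneSpectrum.primesEquiv (R := 𝓞 ℚ)).symm ⟨p, Fact.out⟩).Extension
                (𝓞 (CyclotomicField (cycLevel p k r) ℚ)), w.1.adicCompletion (CyclotomicField (cycLevel p k r) ℚ)))
            (hΨ : ∀ (s : ℚ_[p]) (x : CyclotomicField (cycLevel p k r) ℚ)
              (w : ((Rat.HeightOneSpectrum.primesEquiv (R := 𝓞 ℚ)).symm ⟨p, Fact.out⟩).Extension
                (𝓞 (CyclotomicField (cycLevel p k r) ℚ))),
              Ψ (s ⊗ₜ[ℚ] x) w =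
                algebraMap (CyclotomicField (cycLevel p k r) ℚ) (w.1.adicCompletion (CyclotomicField (cycLevel p k r) ℚ)) x *
                algebraMap (((Rat.HeightOneSpectrum.primesEquiv (R := 𝓞 ℚ)).symm ⟨p, Fact.out⟩).adicCompletion ℚ)
                  (w.1.adicCompletion (CyclotomicField (cycLevel p k r) ℚ)) ((Padic.adicCompletionEquiv (𝓞 ℚ) ⟨p, Fact.out⟩) s)),
            ∃ (w₀ : ((Rat.HeightOneSpectrum.primesEquiv (R := 𝓞 ℚ)).symm ⟨p, Fact.out⟩).Extension
                (𝓞 (CyclotomicField (cycLevel p k r) ℚ)))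
              (g : ((Rat.HeightOneSpectrum.primesEquiv (R := 𝓞 ℚ)).symm ⟨p, Fact.out⟩).Extension
                (𝓞 (CyclotomicField (cycLevel p k r) ℚ)) → absoluteGaloisGroup ℚ)
              (hg : ∀ w : ((Rat.HeightOneSpectrum.primesEquiv (R := 𝓞 ℚ)).symm ⟨p, Fact.out⟩).Extension
                (𝓞 (CyclotomicField (cycLevel p k r) ℚ)),
                sigma (cycLevel p k r) (modNCyclotomicCharacter ℚ (cycLevel p k r) (g w)) • w.1 = w₀.1),
                -- the (propositionally unique) local-field structure proofs at `L_{w₀}` are QUANTIFIED, so that a consumer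
                -- instantiates them with its own terms (no definitional unfolding is then asked of the kernel)
                ∀ (hw₀ : ((p : ℕ) : 𝓞 (CyclotomicField (cycLevel p k r) ℚ)) ∈ w₀.1.asIdeal)
                  [CharZero (w₀.1.adicCompletion (CyclotomicField (cycLevel p k r) ℚ))]
                  [Fact (¬ IsUnit ((p : ℕ) : integerC (w₀.1.adicCompletion (CyclotomicField (cycLevel p k r) ℚ))))]
                  [IsAdicComplete (Ideal.span {((p : ℕ) : integerC (w₀.1.adicCompletion (CyclotomicField (cycLevel p k r) ℚ)))}) (integerC (w₀.1.adicCompletion (CyclotomicField (cycLevel p k r) ℚ)))]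
                  (hL : valuation (w₀.1.adicCompletion (CyclotomicField (cycLevel p k r) ℚ)) ((p : ℕ) : (w₀.1.adicCompletion (CyclotomicField (cycLevel p k r) ℚ))) < 1),
                letI := LocalField.adicCompletionPadicAlgebra w₀.1 p hw₀
                -- the rational tower representation `V_pW|_{Γ_ℚ_v}|_{Γ_{L_w₀}}`, restricted along the COMPOSITE
                -- `Γ_{L_w₀} → Γ_{ℚ_v} → Γ_ℚ` (= `ρV.restrict _` by `ContinuousRep.restrict_comp`, a definitional equality)
                letI ρVT := (W.rationalTateGaloisRep p (W.continuous_rationalGaloisRepTate_holds p)).restrict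
                  ((absGaloisRestrict ℚ (NumberField.Place.Completion (Sum.inr ((Rat.HeightOneSpectrum.primesEquiv (R := 𝓞 ℚ)).symm ⟨p, Fact.out⟩) : NumberField.Place ℚ))).comp
                    (absGaloisRestrict (((Rat.HeightOneSpectrum.primesEquiv (R := 𝓞 ℚ)).symm ⟨p, Fact.out⟩).adicCompletion ℚ) (w₀.1.adicCompletion (CyclotomicField (cycLevel p k r) ℚ))))
                ∃ (dw : (bdRPeriodRingData hL).FilZeroLine ρVT),
                  (∀ (η₀ : contOneCocycles ρT.toTopRep)
                    (η : contOneCocycles (ρT.restrict (absGaloisRestrict (((Rat.HeightOneSpectrum.primesEquiv (R := 𝓞 ℚ)).symm ⟨p, Fact.out⟩).adicCompletion ℚ) (w₀.1.adicCompletion (CyclotomicField (cycLevel p k r) ℚ)))).toTopRep),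
                    (∀ σ, η.1 σ = η₀.1 (absGaloisRestrict (((Rat.HeightOneSpectrum.primesEquiv (R := 𝓞 ℚ)).symm ⟨p, Fact.out⟩).adicCompletion ℚ) (w₀.1.adicCompletion (CyclotomicField (cycLevel p k r) ℚ)) σ)) →
                    (bdRPeriodRingData hL).dualExpCoord
                        (logCyclotomic p) ρVT dw.ω (fun σ => TateModule.toRational p (η.1 σ)) =
                      algebraMap (((Rat.HeightOneSpectrum.primesEquiv (R := 𝓞 ℚ)).symm ⟨p, Fact.out⟩).adicCompletion ℚ) (w₀.1.adicCompletion (CyclotomicField (cycLevel p k r) ℚ))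
                        (expStarCoord W (show valuation (NumberField.Place.Completion (Sum.inr ((Rat.HeightOneSpectrum.primesEquiv (R := 𝓞 ℚ)).symm ⟨p, Fact.out⟩) : NumberField.Place ℚ)) ((p : ℕ) : (NumberField.Place.Completion (Sum.inr ((Rat.HeightOneSpectrum.primesEquiv (R := 𝓞 ℚ)).symm ⟨p, Fact.out⟩) : NumberField.Place ℚ))) < 1 from LocalField.valuation_adicCompletion_natCast_lt_one ((Rat.HeightOneSpectrum.primesEquiv (R := 𝓞 ℚ)).symm ⟨p, Fact.out⟩) p ((natCast_mem_asIdeal_iff_eq_primesEquiv_symm _ (Fact.out : p.Prime)).mpr rfl)) d η₀ : (NumberField.Place.Completion (Sum.inr ((Rat.HeightOneSpectrum.primesEquiv (R := 𝓞 ℚ)).symm ⟨p, Fact.out⟩) : NumberField.Place ℚ)))) ∧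
                  (∀ (w : ((Rat.HeightOneSpectrum.primesEquiv (R := 𝓞 ℚ)).symm ⟨p, Fact.out⟩).Extension
                    (𝓞 (CyclotomicField (cycLevel p k r) ℚ)))
                  (y : H1 (tateRep W p) (cycSubgroup p k r))
                  (φ'' : contOneCocycles (subgroupRep (tateRep W p).toTopRep (cycSubgroup p k r)))
                  (ψT : contOneCocycles (ρT.restrict
                    (absGaloisRestrict (((Rat.HeightOneSpectrum.primesEquiv (R := 𝓞 ℚ)).symm ⟨p, Fact.out⟩).adicCompletion ℚ) (w₀.1.adicCompletion (CyclotomicField (cycLevel p k r) ℚ)))).toTopRep),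
                  oneCocycleClass _ φ'' = conjMap (tateRep W p).toTopRep (cycSubgroup p k r) (g w) 1 y →
                  (∀ σ, ψT.1 σ = φ''.1 ⟨absGaloisRestrictTower ℚ (((Rat.HeightOneSpectrum.primesEquiv (R := 𝓞 ℚ)).symm ⟨p, Fact.out⟩).adicCompletion ℚ) (w₀.1.adicCompletion (CyclotomicField (cycLevel p k r) ℚ)) σ,
                    absGaloisRestrictTower_completion_mem_cycSubgroup p k r w₀ σ⟩) →
                  Ψ (Λ k r y) w = galAdicCompletionMap
                    (sigma (cycLevel p k r) (modNCyclotomicCharacter ℚ (cycLevel p k r) (g w)))⁻¹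
                    (inv_smul_eq_of_smul_eq (hg w))
                    ((bdRPeriodRingData hL).dualExpCoord
                      (logCyclotomic p) ρVT dw.ω (fun σ => TateModule.toRational p (ψT.1 σ))))) ∧
          ∀ (c d a : ℤ) (A : ℕ), 0 < A → Int.gcd c (6 * p * A) = 1 → Int.gcd d (6 * p * N) = 1 →
            ∃ (z : ∀ (k' : ℕ) (r : (cyclotomicLevelsRat p (badPlaces c d A N)).Ideals),
                  H1 (tateRep W p) ((cyclotomicLevelsRat p (badPlaces c d A N)).level k' r.1))
              (x : ∀ (k' : ℕ) (r : (cyclotomicLevelsRat p (badPlaces c d A N)).Ideals),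
                  CyclotomicField (cycLevel p k' r.1) ℚ),
              ZetaBody W p f ι κK Λ c d a A z x


/-! ## The MATRIX of the named fact, as a predicate (appended by seat bsd-addord-w2-c4 gen 13, 2026-08-27)

The body of `exists_eulerSystem_definedExpStar_values` after its leading `κK ≠ 0 ∧`, with the fact's binders
`(W, p, f)` and its existential witnesses `(d, ι, κK, Λ)` turned into PARAMETERS, byte-verbatim otherwise (same
`letI` chain, same private tower-membership lemma, same `ZetaBody`).  Purpose (cell `bsd-addord`, seats w2-acc4 g6 /
planner g24 2026-08-27T16:46–16:47Z): Summits-side consumers can DISPLAY «∃ d ι κK Λ, κK ≠ 0 ∧ EXTRA(d, κK) ∧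
DefinedExpStarBody W p f d ι κK Λ» in a few lines (e.g. the BSD cell's position clause POS) instead of pasting the
80-line matrix, and bridge to the fact BY NAME through `exists_eulerSystem_definedExpStar_values_iff`.  A
DEFINITION (predicate); nothing asserted; the fact above is unchanged. -/

set_option backward.isDefEq.respectTransparency false in
/-- **The matrix `DefinedExpStarBody W p f d ι κK Λ` of `exists_eulerSystem_definedExpStar_values`**: for the datum
`(d, ι, κK, Λ)` — a generator `d` of `D⁰_dR(V_pW|_{Γ_{ℚ_v}})`, embeddings `ι`, a real constant `κK`, value maps
`Λ` — the conjunction «(∀ levels: ∃ w₀ g, ∃ d_w₀, (RES) ∧ (DEF)) ∧ (∀ c d a A guards, ∃ z x, ZetaBody W p f ι κK Λ c d a A z x)»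
VERBATIM from the fact (Kato 2004 (8.1.3)/Ex. 13.3, Prop. 8.12, §9.4 + §11.3, Thm. 9.7, Thm. 6.6 (1) over the DEFINED
semi-local dual exponential of [BlochKato1990] §3).  The fact reads `∀ W p … f, IsNewformOf W f → ∃ d ι κK Λ, κK ≠ 0 ∧
DefinedExpStarBody W p f d ι κK Λ` (`exists_eulerSystem_definedExpStar_values_iff`, `Iff.rfl`).  A predicate; nothing
asserted. [cite: Kato2004Asterisque, (8.1.3) (p. 180), Prop. 8.12 (p. 186), §9.4 (p. 188), Thm. 9.7 (p. 189), §11.3, Thm. 6.6 (1) (p. 163), Ex. 13.3 (pp. 224–225)]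
[cite: BlochKato1990, Def. 3.10 and §3] [cite: Kato1993LNM1553, Ch. II §1.2.4]
[cite: CasselsFrohlichANT1967, Ch. II §10 Theorem (10.2) and Ch. VII §1.1] -/
def DefinedExpStarBody (W : WeierstrassCurve ℚ) [W.IsElliptic] (p : ℕ) [Fact p.Prime]
    [ContinuousSMul ℤ_[p] (W.tateModule p)] [Module.Free ℤ_[p] (W.tateModule p)]
    [Module.Finite ℤ_[p] (W.tateModule p)]
    {N : ℕ} [NeZero N] (f : CuspForm (Gamma0 N) 2)
    (d :
      letI ρV := restrictedRationalTateRep W (NumberField.Place.Completion (Sum.inr ((Rat.HeightOneSpectrum.primesEquiv (R := 𝓞 ℚ)).symm ⟨p, Fact.out⟩) : NumberField.Place ℚ)) p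
      letI : ValuativeRel (NumberField.Place.Completion (Sum.inr ((Rat.HeightOneSpectrum.primesEquiv (R := 𝓞 ℚ)).symm ⟨p, Fact.out⟩) : NumberField.Place ℚ)) :=
        inferInstanceAs (ValuativeRel (((Rat.HeightOneSpectrum.primesEquiv (R := 𝓞 ℚ)).symm ⟨p, Fact.out⟩).adicCompletion ℚ))
      letI : TopologicalSpace (NumberField.Place.Completion (Sum.inr ((Rat.HeightOneSpectrum.primesEquiv (R := 𝓞 ℚ)).symm ⟨p, Fact.out⟩) : NumberField.Place ℚ)) :=
        inferInstanceAs (TopologicalSpace (((Rat.HeightOneSpectrum.primesEquiv (R := 𝓞 ℚ)).symm ⟨p, Fact.out⟩).adicCompletion ℚ))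
      haveI : IsNonarchimedeanLocalField (NumberField.Place.Completion (Sum.inr ((Rat.HeightOneSpectrum.primesEquiv (R := 𝓞 ℚ)).symm ⟨p, Fact.out⟩) : NumberField.Place ℚ)) :=
        inferInstanceAs (IsNonarchimedeanLocalField (((Rat.HeightOneSpectrum.primesEquiv (R := 𝓞 ℚ)).symm ⟨p, Fact.out⟩).adicCompletion ℚ))
      haveI : CharZero (NumberField.Place.Completion (Sum.inr ((Rat.HeightOneSpectrum.primesEquiv (R := 𝓞 ℚ)).symm ⟨p, Fact.out⟩) : NumberField.Place ℚ)) := LocalField.charZero_adicCompletion ((Rat.HeightOneSpectrum.primesEquiv (R := 𝓞 ℚ)).symm ⟨p, Fact.out⟩)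
      letI : Algebra ℚ_[p] (NumberField.Place.Completion (Sum.inr ((Rat.HeightOneSpectrum.primesEquiv (R := 𝓞 ℚ)).symm ⟨p, Fact.out⟩) : NumberField.Place ℚ)) :=
        LocalField.adicCompletionPadicAlgebra ((Rat.HeightOneSpectrum.primesEquiv (R := 𝓞 ℚ)).symm ⟨p, Fact.out⟩) p ((natCast_mem_asIdeal_iff_eq_primesEquiv_symm _ (Fact.out : p.Prime)).mpr rfl)
      haveI : Fact (¬ IsUnit ((p : ℕ) : integerC (NumberField.Place.Completion (Sum.inr ((Rat.HeightOneSpectrum.primesEquiv (R := 𝓞 ℚ)).symm ⟨p, Fact.out⟩) : NumberField.Place ℚ)))) :=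
        ⟨not_isUnit_natCast_integerC (show valuation (NumberField.Place.Completion (Sum.inr ((Rat.HeightOneSpectrum.primesEquiv (R := 𝓞 ℚ)).symm ⟨p, Fact.out⟩) : NumberField.Place ℚ)) ((p : ℕ) : (NumberField.Place.Completion (Sum.inr ((Rat.HeightOneSpectrum.primesEquiv (R := 𝓞 ℚ)).symm ⟨p, Fact.out⟩) : NumberField.Place ℚ))) < 1 from LocalField.valuation_adicCompletion_natCast_lt_one ((Rat.HeightOneSpectrum.primesEquiv (R := 𝓞 ℚ)).symm ⟨p, Fact.out⟩) p ((natCast_mem_asIdeal_iff_eq_primesEquiv_symm _ (Fact.out : p.Prime)).mpr rfl))⟩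
      haveI := isAdicComplete_integerC_natCast (show valuation (NumberField.Place.Completion (Sum.inr ((Rat.HeightOneSpectrum.primesEquiv (R := 𝓞 ℚ)).symm ⟨p, Fact.out⟩) : NumberField.Place ℚ)) ((p : ℕ) : (NumberField.Place.Completion (Sum.inr ((Rat.HeightOneSpectrum.primesEquiv (R := 𝓞 ℚ)).symm ⟨p, Fact.out⟩) : NumberField.Place ℚ))) < 1 from LocalField.valuation_adicCompletion_natCast_lt_one ((Rat.HeightOneSpectrum.primesEquiv (R := 𝓞 ℚ)).symm ⟨p, Fact.out⟩) p ((natCast_mem_asIdeal_iff_eq_primesEquiv_symm _ (Fact.out : p.Prime)).mpr rfl))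
      (bdRPeriodRingData (show valuation (NumberField.Place.Completion (Sum.inr ((Rat.HeightOneSpectrum.primesEquiv (R := 𝓞 ℚ)).symm ⟨p, Fact.out⟩) : NumberField.Place ℚ)) ((p : ℕ) : (NumberField.Place.Completion (Sum.inr ((Rat.HeightOneSpectrum.primesEquiv (R := 𝓞 ℚ)).symm ⟨p, Fact.out⟩) : NumberField.Place ℚ))) < 1 from LocalField.valuation_adicCompletion_natCast_lt_one ((Rat.HeightOneSpectrum.primesEquiv (R := 𝓞 ℚ)).symm ⟨p, Fact.out⟩) p ((natCast_mem_asIdeal_iff_eq_primesEquiv_symm _ (Fact.out : p.Prime)).mpr rfl))).FilZeroLine ρV)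
    (ι : (n : ℕ) → (CyclotomicField n ℚ →+* ℂ)) (κK : ℝ)
      (Λ : ∀ (k' : ℕ) (r : Finset (HeightOneSpectrum (𝓞 ℚ))),
        H1 (tateRep W p) (cycSubgroup p k' r) →ₗ[ℤ_[p]]
          ℚ_[p] ⊗[ℚ] CyclotomicField (cycLevel p k' r) ℚ) : Prop :=
  letI ρT := restrictedTateRep W (NumberField.Place.Completion (Sum.inr ((Rat.HeightOneSpectrum.primesEquiv (R := 𝓞 ℚ)).symm ⟨p, Fact.out⟩) : NumberField.Place ℚ)) p
  letI : ValuativeRel (NumberField.Place.Completion (Sum.inr ((Rat.HeightOneSpectrum.primesEquiv (R := 𝓞 ℚ)).symm ⟨p, Fact.out⟩) : NumberField.Place ℚ)) :=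
    inferInstanceAs (ValuativeRel (((Rat.HeightOneSpectrum.primesEquiv (R := 𝓞 ℚ)).symm ⟨p, Fact.out⟩).adicCompletion ℚ))
  letI : TopologicalSpace (NumberField.Place.Completion (Sum.inr ((Rat.HeightOneSpectrum.primesEquiv (R := 𝓞 ℚ)).symm ⟨p, Fact.out⟩) : NumberField.Place ℚ)) :=
    inferInstanceAs (TopologicalSpace (((Rat.HeightOneSpectrum.primesEquiv (R := 𝓞 ℚ)).symm ⟨p, Fact.out⟩).adicCompletion ℚ))
  haveI : IsNonarchimedeanLocalField (NumberField.Place.Completion (Sum.inr ((Rat.HeightOneSpectrum.primesEquiv (R := 𝓞 ℚ)).symm ⟨p, Fact.out⟩) : NumberField.Place ℚ)) :=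
    inferInstanceAs (IsNonarchimedeanLocalField (((Rat.HeightOneSpectrum.primesEquiv (R := 𝓞 ℚ)).symm ⟨p, Fact.out⟩).adicCompletion ℚ))
  haveI : CharZero (NumberField.Place.Completion (Sum.inr ((Rat.HeightOneSpectrum.primesEquiv (R := 𝓞 ℚ)).symm ⟨p, Fact.out⟩) : NumberField.Place ℚ)) := LocalField.charZero_adicCompletion ((Rat.HeightOneSpectrum.primesEquiv (R := 𝓞 ℚ)).symm ⟨p, Fact.out⟩)
  letI : Algebra ℚ_[p] (NumberField.Place.Completion (Sum.inr ((Rat.HeightOneSpectrum.primesEquiv (R := 𝓞 ℚ)).symm ⟨p, Fact.out⟩) : NumberField.Place ℚ)) :=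
    LocalField.adicCompletionPadicAlgebra ((Rat.HeightOneSpectrum.primesEquiv (R := 𝓞 ℚ)).symm ⟨p, Fact.out⟩) p ((natCast_mem_asIdeal_iff_eq_primesEquiv_symm _ (Fact.out : p.Prime)).mpr rfl)
  haveI : Fact (¬ IsUnit ((p : ℕ) : integerC (NumberField.Place.Completion (Sum.inr ((Rat.HeightOneSpectrum.primesEquiv (R := 𝓞 ℚ)).symm ⟨p, Fact.out⟩) : NumberField.Place ℚ)))) :=
    ⟨not_isUnit_natCast_integerC (show valuation (NumberField.Place.Completion (Sum.inr ((Rat.HeightOneSpectrum.primesEquiv (R := 𝓞 ℚ)).symm ⟨p, Fact.out⟩) : NumberField.Place ℚ)) ((p : ℕ) : (NumberField.Place.Completion (Sum.inr ((Rat.HeightOneSpectrum.primesEquiv (R := 𝓞 ℚ)).symm ⟨p, Fact.out⟩) : NumberField.Place ℚ))) < 1 from LocalField.valuation_adicCompletion_natCast_lt_one ((Rat.HeightOneSpectrum.primesEquiv (R := 𝓞 ℚ)).symm ⟨p, Fact.out⟩) p ((natCast_mem_asIdeal_iff_eq_primesEquiv_symm _ (Fact.out : p.Prime)).mpr rfl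))⟩
  haveI := isAdicComplete_integerC_natCast (show valuation (NumberField.Place.Completion (Sum.inr ((Rat.HeightOneSpectrum.primesEquiv (R := 𝓞 ℚ)).symm ⟨p, Fact.out⟩) : NumberField.Place ℚ)) ((p : ℕ) : (NumberField.Place.Completion (Sum.inr ((Rat.HeightOneSpectrum.primesEquiv (R := 𝓞 ℚ)).symm ⟨p, Fact.out⟩) : NumberField.Place ℚ))) < 1 from LocalField.valuation_adicCompletion_natCast_lt_one ((Rat.HeightOneSpectrum.primesEquiv (R := 𝓞 ℚ)).symm ⟨p, Fact.out⟩) p ((natCast_mem_asIdeal_iff_eq_primesEquiv_symm _ (Fact.out : p.Prime)).mpr rfl))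
  (∀ (k : ℕ) (r : Finset (HeightOneSpectrum (𝓞 ℚ)))
    (Ψ : ℚ_[p] ⊗[ℚ] CyclotomicField (cycLevel p k r) ℚ ≃ₐ[ℚ]
      (Π w : ((Rat.HeightOneSpectrum.primesEquiv (R := 𝓞 ℚ)).symm ⟨p, Fact.out⟩).Extension
        (𝓞 (CyclotomicField (cycLevel p k r) ℚ)), w.1.adicCompletion (CyclotomicField (cycLevel p k r) ℚ)))
    (hΨ : ∀ (s : ℚ_[p]) (x : CyclotomicField (cycLevel p k r) ℚ)
      (w : ((Rat.HeightOneSpectrum.primesEquiv (R := 𝓞 ℚ)).symm ⟨p, Fact.out⟩).Extension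
        (𝓞 (CyclotomicField (cycLevel p k r) ℚ))),
      Ψ (s ⊗ₜ[ℚ] x) w =
        algebraMap (CyclotomicField (cycLevel p k r) ℚ) (w.1.adicCompletion (CyclotomicField (cycLevel p k r) ℚ)) x *
        algebraMap (((Rat.HeightOneSpectrum.primesEquiv (R := 𝓞 ℚ)).symm ⟨p, Fact.out⟩).adicCompletion ℚ)
          (w.1.adicCompletion (CyclotomicField (cycLevel p k r) ℚ)) ((Padic.adicCompletionEquiv (𝓞 ℚ) ⟨p, Fact.out⟩) s)),
    ∃ (w₀ : ((Rat.HeightOneSpectrum.primesEquiv (R := 𝓞 ℚ)).symm ⟨p, Fact.out⟩).Extension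
        (𝓞 (CyclotomicField (cycLevel p k r) ℚ)))
      (g : ((Rat.HeightOneSpectrum.primesEquiv (R := 𝓞 ℚ)).symm ⟨p, Fact.out⟩).Extension
        (𝓞 (CyclotomicField (cycLevel p k r) ℚ)) → absoluteGaloisGroup ℚ)
      (hg : ∀ w : ((Rat.HeightOneSpectrum.primesEquiv (R := 𝓞 ℚ)).symm ⟨p, Fact.out⟩).Extension
        (𝓞 (CyclotomicField (cycLevel p k r) ℚ)),
        sigma (cycLevel p k r) (modNCyclotomicCharacter ℚ (cycLevel p k r) (g w)) • w.1 = w₀.1),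
        -- the (propositionally unique) local-field structure proofs at `L_{w₀}` are QUANTIFIED, so that a consumer
        -- instantiates them with its own terms (no definitional unfolding is then asked of the kernel)
        ∀ (hw₀ : ((p : ℕ) : 𝓞 (CyclotomicField (cycLevel p k r) ℚ)) ∈ w₀.1.asIdeal)
          [CharZero (w₀.1.adicCompletion (CyclotomicField (cycLevel p k r) ℚ))]
          [Fact (¬ IsUnit ((p : ℕ) : integerC (w₀.1.adicCompletion (CyclotomicField (cycLevel p k r) ℚ))))]
          [IsAdicComplete (Ideal.span {((p : ℕ) : integerC (w₀.1.adicCompletion (CyclotomicField (cycLevel p k r) ℚ)))}) (integerC (w₀.1.adicCompletion (CyclotomicField (cycLevel p k r) ℚ)))]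
          (hL : valuation (w₀.1.adicCompletion (CyclotomicField (cycLevel p k r) ℚ)) ((p : ℕ) : (w₀.1.adicCompletion (CyclotomicField (cycLevel p k r) ℚ))) < 1),
        letI := LocalField.adicCompletionPadicAlgebra w₀.1 p hw₀
        -- the rational tower representation `V_pW|_{Γ_ℚ_v}|_{Γ_{L_w₀}}`, restricted along the COMPOSITE
        -- `Γ_{L_w₀} → Γ_{ℚ_v} → Γ_ℚ` (= `ρV.restrict _` by `ContinuousRep.restrict_comp`, a definitional equality)
        letI ρVT := (W.rationalTateGaloisRep p (W.continuous_rationalGaloisRepTate_holds p)).restrict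
          ((absGaloisRestrict ℚ (NumberField.Place.Completion (Sum.inr ((Rat.HeightOneSpectrum.primesEquiv (R := 𝓞 ℚ)).symm ⟨p, Fact.out⟩) : NumberField.Place ℚ))).comp
            (absGaloisRestrict (((Rat.HeightOneSpectrum.primesEquiv (R := 𝓞 ℚ)).symm ⟨p, Fact.out⟩).adicCompletion ℚ) (w₀.1.adicCompletion (CyclotomicField (cycLevel p k r) ℚ))))
        ∃ (dw : (bdRPeriodRingData hL).FilZeroLine ρVT),
          (∀ (η₀ : contOneCocycles ρT.toTopRep)
            (η : contOneCocycles (ρT.restrict (absGaloisRestrict (((Rat.HeightOneSpectrum.primesEquiv (R := 𝓞 ℚ)).symm ⟨p, Fact.out⟩).adicCompletion ℚ) (w₀.1.adicCompletion (CyclotomicField (cycLevel p k r) ℚ)))).toTopRep),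
            (∀ σ, η.1 σ = η₀.1 (absGaloisRestrict (((Rat.HeightOneSpectrum.primesEquiv (R := 𝓞 ℚ)).symm ⟨p, Fact.out⟩).adicCompletion ℚ) (w₀.1.adicCompletion (CyclotomicField (cycLevel p k r) ℚ)) σ)) →
            (bdRPeriodRingData hL).dualExpCoord
                (logCyclotomic p) ρVT dw.ω (fun σ => TateModule.toRational p (η.1 σ)) =
              algebraMap (((Rat.HeightOneSpectrum.primesEquiv (R := 𝓞 ℚ)).symm ⟨p, Fact.out⟩).adicCompletion ℚ) (w₀.1.adicCompletion (CyclotomicField (cycLevel p k r) ℚ))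
                (expStarCoord W (show valuation (NumberField.Place.Completion (Sum.inr ((Rat.HeightOneSpectrum.primesEquiv (R := 𝓞 ℚ)).symm ⟨p, Fact.out⟩) : NumberField.Place ℚ)) ((p : ℕ) : (NumberField.Place.Completion (Sum.inr ((Rat.HeightOneSpectrum.primesEquiv (R := 𝓞 ℚ)).symm ⟨p, Fact.out⟩) : NumberField.Place ℚ))) < 1 from LocalField.valuation_adicCompletion_natCast_lt_one ((Rat.HeightOneSpectrum.primesEquiv (R := 𝓞 ℚ)).symm ⟨p, Fact.out⟩) p ((natCast_mem_asIdeal_iff_eq_primesEquiv_symm _ (Fact.out : p.Prime)).mpr rfl)) d η₀ : (NumberField.Place.Completion (Sum.inr ((Rat.HeightOneSpectrum.primesEquiv (R := 𝓞 ℚ)).symm ⟨p, Fact.out⟩) : NumberField.Place ℚ)))) ∧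
          (∀ (w : ((Rat.HeightOneSpectrum.primesEquiv (R := 𝓞 ℚ)).symm ⟨p, Fact.out⟩).Extension
            (𝓞 (CyclotomicField (cycLevel p k r) ℚ)))
          (y : H1 (tateRep W p) (cycSubgroup p k r))
          (φ'' : contOneCocycles (subgroupRep (tateRep W p).toTopRep (cycSubgroup p k r)))
          (ψT : contOneCocycles (ρT.restrict
            (absGaloisRestrict (((Rat.HeightOneSpectrum.primesEquiv (R := 𝓞 ℚ)).symm ⟨p, Fact.out⟩).adicCompletion ℚ) (w₀.1.adicCompletion (CyclotomicField (cycLevel p k r) ℚ)))).toTopRep),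
          oneCocycleClass _ φ'' = conjMap (tateRep W p).toTopRep (cycSubgroup p k r) (g w) 1 y →
          (∀ σ, ψT.1 σ = φ''.1 ⟨absGaloisRestrictTower ℚ (((Rat.HeightOneSpectrum.primesEquiv (R := 𝓞 ℚ)).symm ⟨p, Fact.out⟩).adicCompletion ℚ) (w₀.1.adicCompletion (CyclotomicField (cycLevel p k r) ℚ)) σ,
            absGaloisRestrictTower_completion_mem_cycSubgroup p k r w₀ σ⟩) →
          Ψ (Λ k r y) w = galAdicCompletionMap
            (sigma (cycLevel p k r) (modNCyclotomicCharacter ℚ (cycLevel p k r) (g w)))⁻¹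
            (inv_smul_eq_of_smul_eq (hg w))
            ((bdRPeriodRingData hL).dualExpCoord
              (logCyclotomic p) ρVT dw.ω (fun σ => TateModule.toRational p (ψT.1 σ))))) ∧
  ∀ (c d a : ℤ) (A : ℕ), 0 < A → Int.gcd c (6 * p * A) = 1 → Int.gcd d (6 * p * N) = 1 →
    ∃ (z : ∀ (k' : ℕ) (r : (cyclotomicLevelsRat p (badPlaces c d A N)).Ideals),
          H1 (tateRep W p) ((cyclotomicLevelsRat p (badPlaces c d A N)).level k' r.1))
      (x : ∀ (k' : ℕ) (r : (cyclotomicLevelsRat p (badPlaces c d A N)).Ideals),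
          CyclotomicField (cycLevel p k' r.1) ℚ),
      ZetaBody W p f ι κK Λ c d a A z x

set_option backward.isDefEq.respectTransparency false in
/-- **`exists_eulerSystem_definedExpStar_values` ↔ its binders followed by `∃ d ι κK Λ, κK ≠ 0 ∧ DefinedExpStarBody W p f d ι κK Λ`**
(definitional unfolding, `Iff.rfl`): the by-name bridge between the fact and its matrix predicate.
[cite: Kato2004Asterisque, §9.4 (p. 188), Thm. 9.7 (p. 189), Ex. 13.3 (pp. 224–225)] -/
theorem exists_eulerSystem_definedExpStar_values_iff :
    exists_eulerSystem_definedExpStar_values ↔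
      ∀ (W : WeierstrassCurve ℚ) [W.IsElliptic] (p : ℕ) [Fact p.Prime]
        [ContinuousSMul ℤ_[p] (W.tateModule p)] [Module.Free ℤ_[p] (W.tateModule p)]
        [Module.Finite ℤ_[p] (W.tateModule p)],
        W.HasIrreducibleModPGaloisRep p →
        ∀ {N : ℕ} [NeZero N] (f : CuspForm (Gamma0 N) 2), IsNewformOf W f →
          ∃ d ι κK Λ, κK ≠ 0 ∧ DefinedExpStarBody W p f d ι κK Λ :=
  Iff.rfl

end Fact

end Literature.NumberTheory.EllipticCurves.Kato2004

end
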